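import Mathlib
import Literature.Analysis.FluidPDE.HardSphereCollisionRecord
import Literature.Analysis.FluidPDE.HardSphereTorusMeasure
import Literature.MathematicalPhysics.KineticTheory.HardSphereEuler
import Literature.MathematicalPhysics.KineticTheory.HardSphereEulerProofs
import HarnessLib

/-!
# `OneFlightGossipEngine.OneFlightLayeredChaos` — brick: quartic-moment tail of a velocity difference
(crux stmt-AtomisticToContinuum-14535, line `Sketch`, lead c4 wave 2; registered stub
`pi_gaussMeasure_norm_sub_ge_le`)

A brick of the first-rung transfer `TwoDirectionGhostInput → FirstFlightGhostInput` of the crux. The frozen-velocity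
law of the first rung is the product Maxwellian `γ = ⨂_{k < n} N(0, θ₀ I₃)`
(`Measure.pi fun _ => gaussMeasure 0 θ₀`); the transfer discards the velocities with a large relative speed
`‖v i − v j‖ ≥ M` (wrap-around of the relative free flight inside the kinetic window) and needs their `γ`-mass to be
`O(m₄ / M⁴)`, `m₄ := ∫ ‖u‖⁴ dN(0, θ₀ I₃)` (finite by Fernique's theorem).  We prove

`γ {v | M ≤ ‖v i − v j‖} ≤ 32 m₄ / M⁴`.

Proof.  Triangle inequality: `{M ≤ ‖v i − v j‖} ⊆ {M/2 ≤ ‖v i‖} ∪ {M/2 ≤ ‖v j‖}`; the one-coordinate marginal of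
`γ` is `N(0, θ₀ I₃)` (`measurePreserving_eval`); Markov's inequality at order four,
`N(0, θ₀ I₃) {M/2 ≤ ‖u‖} ≤ (M/2)⁻⁴ m₄ = 16 m₄ / M⁴`; union bound.

References: C. Cercignani, R. Illner, M. Pulvirenti, *The Mathematical Theory of Dilute Gases* (1994) §4.2
(Maxwellian velocity tails under the equilibrium measure).
-/

open scoped ENNReal
open MeasureTheory ProbabilityTheory Set Filter
open Literature.MathematicalPhysics.KineticTheory

namespace Summit.AtomisticToContinuum.HydrodynamicLimit.Theorems.OLC

/-- **Quartic Chebyshev bound for the Maxwellian speed**: `N(0, θ I₃) {u | V ≤ ‖u‖} ≤ V⁻⁴ ∫ ‖u‖⁴ dN(0, θ I₃)` for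
`V > 0` (Markov's inequality for `‖u‖⁴`; the quartic moment is finite by Fernique's theorem). [folklore] -/
theorem gaussMeasure_norm_ge_le_moment_four (θ : ℝ) {V : ℝ} (hV : 0 < V) :
    gaussMeasure (0 : V3) θ {u | V ≤ ‖u‖} ≤
      ENNReal.ofReal ((∫ u, ‖u‖ ^ 4 ∂(gaussMeasure (0 : V3) θ)) / V ^ 4) := by
  have h4 : Integrable (fun u : V3 => ‖u‖ ^ 4) (gaussMeasure (0 : V3) θ) :=
    (IsGaussian.memLp_id _ 4 (by simp)).integrable_norm_pow (by norm_num)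
  have hV4 : 0 < V ^ 4 := pow_pos hV 4
  have hsub : {u : V3 | V ≤ ‖u‖} ⊆ {u | ENNReal.ofReal (V ^ 4) ≤ ENNReal.ofReal (‖u‖ ^ 4)} :=
    fun u hu => ENNReal.ofReal_le_ofReal (pow_le_pow_left₀ hV.le hu 4)
  calc gaussMeasure (0 : V3) θ {u | V ≤ ‖u‖}
      ≤ gaussMeasure (0 : V3) θ {u | ENNReal.ofReal (V ^ 4) ≤ ENNReal.ofReal (‖u‖ ^ 4)} := measure_mono hsub
    _ ≤ (∫⁻ u, ENNReal.ofReal (‖u‖ ^ 4) ∂(gaussMeasure (0 : V3) θ)) / ENNReal.ofReal (V ^ 4) :=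
        meas_ge_le_lintegral_div ((measurable_norm.pow_const 4).ennreal_ofReal).aemeasurable
          (ENNReal.ofReal_pos.2 hV4).ne' ENNReal.ofReal_ne_top
    _ = ENNReal.ofReal (∫ u, ‖u‖ ^ 4 ∂(gaussMeasure (0 : V3) θ)) / ENNReal.ofReal (V ^ 4) := by
        rw [ofReal_integral_eq_lintegral_ofReal h4 (Eventually.of_forall fun u => by positivity)]
    _ = ENNReal.ofReal ((∫ u, ‖u‖ ^ 4 ∂(gaussMeasure (0 : V3) θ)) / V ^ 4) :=
        (ENNReal.ofReal_div_of_pos hV4).symm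

/-- **One-coordinate marginal of the product Maxwellian**: under `⨂_{k < n} N(0, θ I₃)` the speed of particle `k`
has the one-body tail `N(0, θ I₃) {u | V ≤ ‖u‖}` (`measurePreserving_eval`). [folklore] -/
theorem pi_gaussMeasure_norm_eval_ge_eq (θ : ℝ) {n : ℕ} (k : Fin n) (V : ℝ) :
    (Measure.pi fun _ : Fin n => gaussMeasure (0 : V3) θ) {v | V ≤ ‖v k‖} =
      gaussMeasure (0 : V3) θ {u | V ≤ ‖u‖} := by
  have hB : MeasurableSet {u : V3 | V ≤ ‖u‖} := measurableSet_le measurable_const measurable_norm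
  rw [← (measurePreserving_eval (fun _ : Fin n => gaussMeasure (0 : V3) θ) k).measure_preimage
    hB.nullMeasurableSet]
  rfl

/-- **Quartic-moment tail of a velocity difference under the product Maxwellian** (registered stub
`pi_gaussMeasure_norm_sub_ge_le` of crux stmt-AtomisticToContinuum-14535, line `Sketch`).  For `M > 0` and any two
particles `i, j`,
`(⨂_{k < n} N(0, θ₀ I₃)) {v | M ≤ ‖v i − v j‖} ≤ 32 M⁻⁴ ∫ ‖u‖⁴ dN(0, θ₀ I₃)`:
triangle inequality `{M ≤ ‖v i − v j‖} ⊆ {M/2 ≤ ‖v i‖} ∪ {M/2 ≤ ‖v j‖}`, one-coordinate marginals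
(`pi_gaussMeasure_norm_eval_ge_eq`), quartic Chebyshev (`gaussMeasure_norm_ge_le_moment_four`) giving `16 m₄ / M⁴`
each, union bound. [folklore] -/
theorem pi_gaussMeasure_norm_sub_ge_le : ∀ (θ₀ : ℝ) {n : ℕ} (i j : Fin n) {M : ℝ}, 0 < M → (MeasureTheory.Measure.pi fun _ : Fin n => Literature.MathematicalPhysics.KineticTheory.gaussMeasure (0 : Literature.MathematicalPhysics.KineticTheory.V3) θ₀) {v | M ≤ ‖v i - v j‖} ≤ ENNReal.ofReal (32 * (∫ u, ‖u‖ ^ 4 ∂(Literature.MathematicalPhysics.KineticTheory.gaussMeasure (0 : Literature.MathematicalPhysics.KineticTheory.V3) θ₀)) / M ^ 4) := by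
  intro θ₀ n i j M hM
  set m : ℝ := ∫ u, ‖u‖ ^ 4 ∂(gaussMeasure (0 : V3) θ₀) with hm
  set γ : Measure (Fin n → V3) := Measure.pi fun _ : Fin n => gaussMeasure (0 : V3) θ₀ with hγ
  have hm0 : 0 ≤ m := integral_nonneg fun u => by positivity
  have hM2 : 0 < M / 2 := by positivity
  -- triangle inequality
  have hsub : {v : Fin n → V3 | M ≤ ‖v i - v j‖} ⊆ {v | M / 2 ≤ ‖v i‖} ∪ {v | M / 2 ≤ ‖v j‖} := by
    intro v hv
    simp only [Set.mem_setOf_eq, Set.mem_union] at hv ⊢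
    by_contra h
    push Not at h
    have h3 := norm_sub_le (v i) (v j)
    linarith [h.1, h.2]
  -- one particle: marginal + quartic Chebyshev
  have hone : ∀ k : Fin n, γ {v | M / 2 ≤ ‖v k‖} ≤ ENNReal.ofReal (16 * m / M ^ 4) := by
    intro k
    rw [hγ, pi_gaussMeasure_norm_eval_ge_eq θ₀ k (M / 2)]
    refine (gaussMeasure_norm_ge_le_moment_four θ₀ hM2).trans_eq ?_
    rw [← hm]
    congr 1
    field_simp
    ring
  calc γ {v | M ≤ ‖v i - v j‖}
      ≤ γ ({v | M / 2 ≤ ‖v i‖} ∪ {v | M / 2 ≤ ‖v j‖}) := measure_mono hsub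
    _ ≤ γ {v | M / 2 ≤ ‖v i‖} + γ {v | M / 2 ≤ ‖v j‖} := measure_union_le _ _
    _ ≤ ENNReal.ofReal (16 * m / M ^ 4) + ENNReal.ofReal (16 * m / M ^ 4) := add_le_add (hone i) (hone j)
    _ = ENNReal.ofReal (32 * m / M ^ 4) := by
        rw [← ENNReal.ofReal_add (by positivity) (by positivity)]
        congr 1
        ring

end Summit.AtomisticToContinuum.HydrodynamicLimit.Theorems.OLC
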